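import Mathlib
import HarnessLib
import Summits.AtomisticToContinuum.Crystallization.Theorems.PricedLinkCensusSoftLayerPropagationStubBallPropagationRecursionStep
import Summits.AtomisticToContinuum.Crystallization.Theorems.PricedLinkCensusSoftLayerPropagationStubBallPropagationPairs

/-!
# Local layer-propagation lemmas for the finite-ball form of Hales, *Dense Sphere Packings* §1.3 (IX b):
# all the layers above a certified base disc

Route `PricedLinkCensus`, crux `SoftLayerPropagation` (stmt-AtomisticToContinuum-14233), line
`Sketch`, helper file for the stub `stub_ballPropagation` (uses `…RecursionStep.lean`, `…Pairs.lean`).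

`layers_up`: iterating `layer_step` from a certified base disc, reading the sign of each new layer
off its centre nearest to the axis (`exists_mem_holeTriple_norm_sq_add_le_two`) and spreading it over
the certified disc (`lattice_disc_induction`, `holeTriple_type_eq_of_adjacent_dir`): the layers of
the Barlow stacking of a Hägg word, certified on discs of prescribed radii under real-arithmetic
hypotheses on those radii.

All statements are elementary ([folklore]) or cite DSP §1.3.
-/

noncomputable section

namespace Summit.AtomisticToContinuum.Crystallization.Theorems

open Literature.Geometry.DiscreteGeometry Literature.MathematicalPhysics.StatisticalMechanics
open RealInnerProductSpace

/-! ### All the layers above a certified base disc -/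

section Layers

variable {V : Set (EuclideanSpace ℝ (Fin 3))}

/-- The upper type read off a layer shell: `w + 𝗁e₃` is a shell point iff the type above is `1`.
[folklore] -/
theorem ite_mem_kissingShell_eq {y : EuclideanSpace ℝ (Fin 3)} {σ σ' : ℝ} (hσ : σ = 1 ∨ σ = -1)
    (h : kissingShell V y = layerShell σ σ')
    [Decidable (barlowOffset 2 + layerNormal layerSpacing ∈ kissingShell V y)] :
    (if barlowOffset 2 + layerNormal layerSpacing ∈ kissingShell V y then (1 : ℝ) else -1) = σ := by
  have hw : (barlowOffset 2 : EuclideanSpace ℝ (Fin 3)) ∈ holeTriple 1 := by simp [holeTriple]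
  have key : barlowOffset 2 + layerNormal layerSpacing ∈ layerShell σ σ' ↔ σ = 1 := by
    constructor
    · intro hm
      rcases mem_layerShell_iff.1 hm with h1 | h1 | h1
      · have := apply_two_of_mem_hexagonSet h1
        simp only [PiLp.add_apply, frameW_apply_two, frameE_apply_two, zero_add] at this
        exact absurd this layerSpacing_pos.ne'
      · rw [add_sub_cancel_right] at h1
        exact (eq_of_mem_holeTriple_of_mem_holeTriple hσ (Or.inl rfl) h1 hw)
      · have := apply_two_of_mem_holeTriple h1
        simp only [PiLp.add_apply, frameW_apply_two, frameE_apply_two, zero_add] at this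
        linarith [layerSpacing_pos]
    · rintro rfl
      exact mem_layerShell_iff.2 (Or.inr (Or.inl (by simpa using hw)))
  have key' : barlowOffset 2 + layerNormal layerSpacing ∈ kissingShell V y ↔ σ = 1 := by rw [h]; exact key
  by_cases h1 : σ = 1
  · rw [if_pos (key'.2 h1), h1]
  · rw [if_neg (fun hm => h1 (key'.1 hm))]
    rcases hσ with rfl | rfl
    · exact absurd rfl h1
    · rfl

/-- **All the layers above a certified base disc.**  In the frame, let the base layer `ℤu₁ + ℤu₂`
be certified on the disc `‖p − c‖ ≤ ρ 0` about the horizontal point `c` (every lattice point a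
centre with shell `layerShell σ₀ σ₀′`), with a lattice point within `√2` of `c`.  Give radii
`ρ (n+1)` for the layers above and ring radii `R n`, subject to the real-arithmetic hypotheses of
`layer_step` (`hR`, `hpar`), the pattern hypothesis on the cylinder pieces (`hgoodρ`) and, layer by
layer, either the FCC-zone hypothesis or the far-corner inequality (`hzoneρ`), and `√2 ≤ ρ n`.
Then there is a sign sequence `s` (`s 0 = σ₀`) such that layer `n + 1` is the affine lattice
`ℤu₁ + ℤu₂ + (s 0 + ⋯ + s n) w + (n+1) 𝗁e₃` and every point of it within `ρ (n+1)` of the axis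
through `c` is a centre with shell `layerShell (s (n+1)) (−s n)` — the layers of the Barlow
stacking of the Hägg word `s`, certified on the discs.  (The sign `s (n+1)` is read off the
centre of layer `n+1` nearest to the axis, `exists_mem_holeTriple_norm_sq_add_le_two`; it is the
same at all certified points of the layer by `lattice_disc_induction` and
`holeTriple_type_eq_of_adjacent_dir`.) [cite: HalesDSP2012, §1.3] -/
theorem layers_up (hV : IsUnitBallPacking V) {c : EuclideanSpace ℝ (Fin 3)} (hc : c 2 = 0)
    (good zone : EuclideanSpace ℝ (Fin 3) → Prop)
    (hgood : ∀ y ∈ V, good y →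
      IsArrangedIn (kissingShell V y) fccKissingPattern ∨ IsArrangedIn (kissingShell V y) hcpKissingPattern)
    (hzone : ∀ y ∈ V, zone y → IsArrangedIn (kissingShell V y) fccKissingPattern)
    (N : ℕ) (ρ R : ℕ → ℝ) (hρ : ∀ n ≤ N, Real.sqrt 2 ≤ ρ n)
    (hR : ∀ n < N, ∀ r : ℝ, ρ n < r → r ≤ R n →
      ∃ t : ℝ, 0 < t ∧ 4 / 3 * t ^ 2 < r ^ 2 ∧ r ^ 2 - (4 * t - 4) ≤ ρ n ^ 2)
    (hpar : ∀ n < N, ∀ r M : ℝ, 0 ≤ r → r ≤ ρ (n + 1) → 0 ≤ M → r ^ 2 ≤ 3 * M ^ 2 →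
      r ^ 2 - 2 * M + 4 / 3 ≤ ρ n ^ 2)
    (hgoodρ : ∀ n < N, ∀ y ∈ V, y 2 = ((n : ℝ) + 1) * layerSpacing →
      ‖y - (c + ((n : ℝ) + 1) • layerNormal layerSpacing)‖ ≤ ρ (n + 1) → good y)
    (hzoneρ : ∀ n < N, (∀ y ∈ V, y 2 = ((n : ℝ) + 1) * layerSpacing →
      ‖y - (c + ((n : ℝ) + 1) • layerNormal layerSpacing)‖ ≤ ρ (n + 1) → zone y) ∨
      ρ (n + 1) + 4 / Real.sqrt 3 ≤ R n)
    {σ₀ σ₀' : ℝ} (hσ₀ : σ₀ = 1 ∨ σ₀ = -1) {i₀ j₀ : ℤ}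
    (h₀c : ‖((i₀ : ℝ) • (triangularVec₁ 2 : EuclideanSpace ℝ (Fin 3)) + (j₀ : ℝ) • triangularVec₂ 2) - c‖ ^ 2 ≤ 2)
    (hbase : ∀ i j : ℤ,
      ‖((i : ℝ) • (triangularVec₁ 2 : EuclideanSpace ℝ (Fin 3)) + (j : ℝ) • triangularVec₂ 2) - c‖ ≤ ρ 0 →
      (i : ℝ) • (triangularVec₁ 2 : EuclideanSpace ℝ (Fin 3)) + (j : ℝ) • triangularVec₂ 2 ∈ V ∧
      kissingShell V ((i : ℝ) • (triangularVec₁ 2 : EuclideanSpace ℝ (Fin 3)) + (j : ℝ) • triangularVec₂ 2)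
        = layerShell σ₀ σ₀') :
    ∃ s : ℕ → ℝ, s 0 = σ₀ ∧ (∀ n, s n = 1 ∨ s n = -1) ∧
      ∀ n < N, ∀ i j : ℤ,
        ‖((i : ℝ) • (triangularVec₁ 2 : EuclideanSpace ℝ (Fin 3)) + (j : ℝ) • triangularVec₂ 2 +
            (∑ m ∈ Finset.range (n + 1), s m) • barlowOffset 2) - c‖ ≤ ρ (n + 1) →
        (i : ℝ) • (triangularVec₁ 2 : EuclideanSpace ℝ (Fin 3)) + (j : ℝ) • triangularVec₂ 2 +
            (∑ m ∈ Finset.range (n + 1), s m) • barlowOffset 2 +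
            ((n : ℝ) + 1) • layerNormal layerSpacing ∈ V ∧
        kissingShell V ((i : ℝ) • (triangularVec₁ 2 : EuclideanSpace ℝ (Fin 3)) + (j : ℝ) • triangularVec₂ 2 +
            (∑ m ∈ Finset.range (n + 1), s m) • barlowOffset 2 +
            ((n : ℝ) + 1) • layerNormal layerSpacing) = layerShell (s (n + 1)) (-(s n)) := by
  classical
  -- notation
  set Lat : ℤ → ℤ → EuclideanSpace ℝ (Fin 3) := fun i j =>
    (i : ℝ) • (triangularVec₁ 2 : EuclideanSpace ℝ (Fin 3)) + (j : ℝ) • triangularVec₂ 2 with hLat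
  -- the upper type of a centre, the seeds along the axis, the signs
  let up : EuclideanSpace ℝ (Fin 3) → ℝ := fun y =>
    if barlowOffset 2 + layerNormal layerSpacing ∈ kissingShell V y then 1 else -1
  let T : ℕ → EuclideanSpace ℝ (Fin 3) → EuclideanSpace ℝ (Fin 3) := fun n x =>
    Classical.epsilon fun t : EuclideanSpace ℝ (Fin 3) =>
      t ∈ holeTriple (up (x + (n : ℝ) • layerNormal layerSpacing)) ∧ ‖x + t - c‖ ^ 2 ≤ 2
  let hseed : ℕ → EuclideanSpace ℝ (Fin 3) := fun n =>
    Nat.rec (motive := fun _ => EuclideanSpace ℝ (Fin 3)) (Lat i₀ j₀) (fun m x => x + T m x) n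
  have hseed_zero : hseed 0 = Lat i₀ j₀ := rfl
  have hseed_succ : ∀ n, hseed (n + 1) = hseed n + T n (hseed n) := fun n => rfl
  let s : ℕ → ℝ := fun n => up (hseed n + (n : ℝ) • layerNormal layerSpacing)
  have hs : ∀ n, s n = 1 ∨ s n = -1 := fun n => by
    simp only [s, up]; split_ifs <;> simp
  let S : ℕ → ℝ := fun n => ∑ m ∈ Finset.range n, s m
  have S_zero : S 0 = 0 := by simp [S]
  have S_succ : ∀ n, S (n + 1) = S n + s n := fun n => by simp [S, Finset.sum_range_succ]
  -- offsets and centres of the layers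
  let o : ℕ → EuclideanSpace ℝ (Fin 3) := fun n => S n • barlowOffset 2 + (n : ℝ) • layerNormal layerSpacing
  let cc : ℕ → EuclideanSpace ℝ (Fin 3) := fun n => c - S n • barlowOffset 2
  have hcc : ∀ n, cc n 2 = 0 := fun n => by simp [cc, hc]
  let lowT : ℕ → ℝ := fun n => Nat.rec (motive := fun _ => ℝ) σ₀' (fun m _ => -s m) n
  -- geometry of the offsets
  have o_lat : ∀ n (i j : ℤ), o n + (Lat i j + s n • barlowOffset 2 + layerNormal layerSpacing) =
      o (n + 1) + Lat i j := fun n i j => by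
    simp only [o, S_succ, Nat.cast_succ]; module
  have cc_lat : ∀ n (i j : ℤ), Lat i j + s n • barlowOffset 2 - cc n = Lat i j - cc (n + 1) :=
    fun n i j => by simp only [cc, S_succ]; module
  have o_two : ∀ n, (o n) 2 = (n : ℝ) * layerSpacing := fun n => by simp [o]
  have lat_two : ∀ i j : ℤ, (Lat i j) 2 = 0 := fun i j => by simp [hLat]
  have hρ0 : ∀ n ≤ N, 0 ≤ ρ n := fun n hn => (Real.sqrt_nonneg 2).trans (hρ n hn)
  have hsq2 : (Real.sqrt 2) ^ 2 = 2 := Real.sq_sqrt (by norm_num)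
  have le_of_sq_le_two : ∀ n ≤ N, ∀ x : EuclideanSpace ℝ (Fin 3), ‖x‖ ^ 2 ≤ 2 → ‖x‖ ≤ ρ n := by
    intro n hn x hx
    have h1 : ‖x‖ ^ 2 ≤ ρ n ^ 2 := by nlinarith [hρ n hn, Real.sqrt_nonneg 2]
    exact (pow_le_pow_iff_left₀ (norm_nonneg _) (hρ0 n hn) two_ne_zero).1 h1
  -- `s 0 = σ₀`
  have s0 : s 0 = σ₀ := by
    have h0 : ‖Lat i₀ j₀ - c‖ ≤ ρ 0 := le_of_sq_le_two 0 (Nat.zero_le _) _ h₀c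
    have := ite_mem_kissingShell_eq hσ₀ (hbase i₀ j₀ h0).2
    simpa [s, up, hseed_zero] using this
  -- the claims, by induction on the layer
  have main : ∀ n : ℕ, n ≤ N →
      (∀ i j : ℤ, ‖Lat i j - cc n‖ ≤ ρ n →
        o n + Lat i j ∈ V ∧ kissingShell V (o n + Lat i j) = layerShell (s n) (lowT n)) ∧
      (∃ a b : ℤ, hseed n = Lat a b + S n • barlowOffset 2) ∧ ‖hseed n - c‖ ^ 2 ≤ 2 := by
    intro n
    induction n with
    | zero =>
      intro _
      refine ⟨fun i j hij => ?_, ⟨i₀, j₀, by simp [hseed_zero, S_zero]⟩, by rw [hseed_zero]; exact h₀c⟩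
      have e1 : o 0 + Lat i j = Lat i j := by simp [o, S_zero]
      have e2 : Lat i j - cc 0 = Lat i j - c := by simp [cc, S_zero]
      rw [e2] at hij
      rw [e1, s0]
      exact hbase i j hij
    | succ n ih =>
      intro hn1
      have hn : n < N := Nat.lt_of_succ_le hn1
      obtain ⟨hA, ⟨a, b, hab⟩, hB⟩ := ih hn.le
      -- the layer step from layer `n`
      have LS := layer_step hV (hcc n) (hs n) (ρ := ρ n) (ρ' := ρ (n + 1)) (R := R n) (hρ0 n hn.le)
        (o := o n) (σ' := lowT n) hA (hR n hn) (hpar n hn)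
        (fun i j hr hyV => hgood _ hyV (hgoodρ n hn _ hyV
          (by rw [o_lat]; simp [o_two, lat_two, Nat.cast_succ])
          (by rw [o_lat]
              have e : o (n + 1) + Lat i j - (c + ((n : ℝ) + 1) • layerNormal layerSpacing) =
                  Lat i j - cc (n + 1) := by simp only [o, cc, Nat.cast_succ]; module
              rw [e, ← cc_lat]; exact hr)))
        (by
          rcases hzoneρ n hn with hz | hz
          · left
            intro i j hr hyV
            refine hzone _ hyV (hz _ hyV ?_ ?_)
            · rw [o_lat]; simp [o_two, lat_two, Nat.cast_succ]
            · rw [o_lat]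
              have e : o (n + 1) + Lat i j - (c + ((n : ℝ) + 1) • layerNormal layerSpacing) =
                  Lat i j - cc (n + 1) := by simp only [o, cc, Nat.cast_succ]; module
              rw [e, ← cc_lat]; exact hr
          · exact Or.inr hz)
      -- in the coordinates of layer `n + 1`
      have LS' : ∀ i j : ℤ, ‖Lat i j - cc (n + 1)‖ ≤ ρ (n + 1) →
          o (n + 1) + Lat i j ∈ V ∧ ∃ τ : ℝ, (τ = 1 ∨ τ = -1) ∧
            kissingShell V (o (n + 1) + Lat i j) = layerShell τ (-(s n)) := by
        intro i j hij
        have h := LS i j (by rw [cc_lat]; exact hij)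
        rwa [o_lat] at h
      -- the new seed
      have hseed2 : (hseed n - c) 2 = 0 := by rw [hab]; simp [lat_two, hc]
      have hex : ∃ t : EuclideanSpace ℝ (Fin 3),
          t ∈ holeTriple (up (hseed n + (n : ℝ) • layerNormal layerSpacing)) ∧ ‖hseed n + t - c‖ ^ 2 ≤ 2 := by
        obtain ⟨t, ht, hle⟩ := exists_mem_holeTriple_norm_sq_add_le_two hseed2 hB (hs n)
        exact ⟨t, ht, by
          have e : hseed n + t - c = hseed n - c + t := by abel
          rw [e]; exact hle⟩
      have hT : T n (hseed n) ∈ holeTriple (s n) ∧ ‖hseed n + T n (hseed n) - c‖ ^ 2 ≤ 2 :=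
        Classical.epsilon_spec hex
      obtain ⟨a', b', hab'⟩ := exists_int_smul_frameW_sub_of_mem_holeTriple (hs n) hT.1
      have eT : T n (hseed n) = s n • barlowOffset 2 -
          ((a' : ℝ) • (triangularVec₁ 2 : EuclideanSpace ℝ (Fin 3)) + (b' : ℝ) • triangularVec₂ 2) := by
        rw [← hab']; abel
      have hseed' : hseed (n + 1) = Lat (a - a') (b - b') + S (n + 1) • barlowOffset 2 := by
        rw [hseed_succ, eT, hab, S_succ]
        simp only [hLat]; push_cast; module
      have hB' : ‖hseed (n + 1) - c‖ ^ 2 ≤ 2 := by rw [hseed_succ]; exact hT.2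
      -- the seed is certified, and its upper type is `s (n + 1)`
      have hseedρ : ‖Lat (a - a') (b - b') - cc (n + 1)‖ ≤ ρ (n + 1) := by
        apply le_of_sq_le_two (n + 1) hn1
        have e : Lat (a - a') (b - b') - cc (n + 1) = hseed (n + 1) - c := by
          rw [hseed']; simp only [cc]; abel
        rw [e]; exact hB'
      obtain ⟨hYV, τY, hτY, hYshell⟩ := LS' (a - a') (b - b') hseedρ
      have hsY : s (n + 1) = τY := by
        have := ite_mem_kissingShell_eq hτY hYshell
        have e : hseed (n + 1) + ((n : ℝ) + 1) • layerNormal layerSpacing = o (n + 1) + Lat (a - a') (b - b') := by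
          rw [hseed']; simp only [o, Nat.cast_succ]; module
        simp only [s, up, Nat.cast_succ]
        rw [e]; exact this
      -- all certified points of layer `n + 1` have upper type `s (n + 1)`
      have hA' : ∀ i j : ℤ, ‖Lat i j - cc (n + 1)‖ ≤ ρ (n + 1) →
          o (n + 1) + Lat i j ∈ V ∧ kissingShell V (o (n + 1) + Lat i j) = layerShell (s (n + 1)) (-(s n)) := by
        refine lattice_disc_induction (hcc (n + 1)) (Q := fun i j =>
          o (n + 1) + Lat i j ∈ V ∧ kissingShell V (o (n + 1) + Lat i j) = layerShell (s (n + 1)) (-(s n)))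
          ?_ (i₀ := a - a') (j₀ := b - b') ?_ ⟨hYV, by rw [hsY]; exact hYshell⟩
        · rintro i j ⟨hPV, hPshell⟩ η hη i' j' he hR'
          obtain ⟨hP'V, τ', hτ', hP'shell⟩ := LS' i' j' hR'
          refine ⟨hP'V, ?_⟩
          have heq : o (n + 1) + Lat i j + η = o (n + 1) + Lat i' j' := by
            simp only [hLat] at he ⊢; rw [he]; abel
          have hP : ∀ t ∈ holeTriple (s (n + 1)),
              t + (1 : ℝ) • layerNormal layerSpacing ∈ kissingShell V (o (n + 1) + Lat i j) := by
            intro t ht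
            rw [hPshell, one_smul]
            exact mem_layerShell_iff.2 (Or.inr (Or.inl (by simpa using ht)))
          have hP' : ∀ t ∈ holeTriple τ',
              t + (1 : ℝ) • layerNormal layerSpacing ∈ kissingShell V (o (n + 1) + Lat i j + η) := by
            intro t ht
            rw [heq, hP'shell, one_smul]
            exact mem_layerShell_iff.2 (Or.inr (Or.inl (by simpa using ht)))
          have := holeTriple_type_eq_of_adjacent_dir hV hη (hs (n + 1)) hτ' hP hP'
          rw [hP'shell, this]
        · have e : Lat (a - a') (b - b') - cc (n + 1) = hseed (n + 1) - c := by
            rw [hseed']; simp only [cc]; abel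
          rw [e]; exact hB'
      exact ⟨hA', ⟨a - a', b - b', hseed'⟩, hB'⟩
  refine ⟨s, s0, hs, ?_⟩
  · intro n hn i j hij
    obtain ⟨hA, -, -⟩ := main (n + 1) hn
    have e1 : o (n + 1) + Lat i j = Lat i j + S (n + 1) • barlowOffset 2 +
        ((n : ℝ) + 1) • layerNormal layerSpacing := by
      simp only [o]; push_cast; abel
    have e2 : Lat i j - cc (n + 1) = Lat i j + S (n + 1) • barlowOffset 2 - c := by
      simp only [cc]; abel
    have h := hA i j (by rw [e2]; exact hij)
    rw [e1] at h
    exact h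

end Layers

/-- **The upper type read off a layer shell**: `w + 𝗁e₃` is a shell point iff the type above is
`1`. [folklore] -/
theorem frameW_add_frameE_mem_kissingShell_iff {V : Set (EuclideanSpace ℝ (Fin 3))}
    {y : EuclideanSpace ℝ (Fin 3)} {σ σ' : ℝ} (hσ : σ = 1 ∨ σ = -1)
    (h : kissingShell V y = layerShell σ σ') :
    barlowOffset 2 + layerNormal layerSpacing ∈ kissingShell V y ↔ σ = 1 := by
  classical
  have key := ite_mem_kissingShell_eq (V := V) hσ h
  constructor
  · intro hm
    rw [if_pos hm] at key; exact key.symm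
  · intro h1
    by_contra hm
    rw [if_neg hm] at key
    rcases hσ with rfl | rfl
    · norm_num at key
    · norm_num at h1

/-- **Registered sub-goal `ballPropagation_upTypeIff`** of the crux item (the upper type read off
a layer shell, in closed form: `frameW_add_frameE_mem_kissingShell_iff`). [folklore] -/
theorem ballPropagation_upTypeIff :
    ∀ (V : Set (EuclideanSpace ℝ (Fin 3))) (y : EuclideanSpace ℝ (Fin 3)) (σ σ' : ℝ), (σ = 1 ∨ σ =
    -1) → Literature.Geometry.DiscreteGeometry.kissingShell V y =
    Literature.Geometry.DiscreteGeometry.layerShell σ σ' →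
    (Literature.MathematicalPhysics.StatisticalMechanics.barlowOffset 2 +
    Literature.MathematicalPhysics.StatisticalMechanics.layerNormal
    Literature.Geometry.DiscreteGeometry.layerSpacing ∈
    Literature.Geometry.DiscreteGeometry.kissingShell V y ↔ σ = 1) :=
  fun _ _ _ _ hσ h => frameW_add_frameE_mem_kissingShell_iff hσ h

end Summit.AtomisticToContinuum.Crystallization.Theorems

end
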